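import Summits.QuantumFields.BalabanUV.Beta.D1BFx.GhostQWordLetters
import Summits.QuantumFields.BalabanUV.Beta.D1BFx.GhostLegProfilesRight
import Summits.QuantumFields.BalabanUV.Beta.D1BFx.GhostRowBookkeeping
import Literature.MathematicalPhysics.QuantumFieldTheory.Balaban1983to89.T4RateAlgebra
import Literature.MathematicalPhysics.QuantumFieldTheory.Balaban1983to89.Beta.VolumeImages

/-!
# `BalabanUV.Beta.D1BFx.RestKernelGhostDeltaSharp` — road «BF-x» for binder row D1, slot (K), GHOST-N8-SPEC v0.3 §3 (d3-Δ) «THE SHARP ΔGH ROW»: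
# **THE `cQ`-DEFECT OF THE COMPLETED GHOST KERNEL HAS (1.22) SECOND MOMENT `O(n⁻⁸)` UNIFORMLY ON THE SCALES `n = L^k`** —
# `∃ K, ∀ k ≥ 1, ∀ n = m+1 = L^k, ∀ μ ν, |secondMoment (μ ν z ↦ 2·(PghQ n a (−1) n² 0 μ ν z − PghQ n a (−1) n² a μ ν z)) μ ν| ≤ K·n⁻⁸`, replacing the `KΔ(a)·n⁻¹` of
# `RestKernelGhostDelta.abs_secondMoment_deltaGH_le` at the tower weight

HONEST DEPENDENCY (cell records, verbatim): «continuum YM on T⁴ ⇐ BetaPertH ∧ nine spine estimates (0/9 proved); BetaPertH ⇐ (D1) ∧ (D4) ∧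
CAP+tail; G-an2-4 gates asym, D1 and NE2/3/4.»  HONEST FRAMING (cell contract, verbatim): «discharging `BetaPertH` makes Bałaban's UV stability
UNCONDITIONAL — a real constructive-QFT result; it is NOT the continuum limit and NOT the Clay problem.»  THIS MODULE DISCHARGES NOTHING of the
wall: [folklore] composition BY NAME of this lineage's (Δ1) `GhostQVertexDensity`, (Δ2) `GhostQWordLetters`, F2 `OrientedProfileWords`, F3 P1
`GhostLegProfilesRight` (β2 in the profile currency), F5 P2 `GhostRowBookkeeping`, leaf-04 g18's `GhostDeltaWords.deltaGH_eq_words` and the typer's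
`RestKernelGhostUnit.abs_secondMoment_le`.  The INPUT LAW is β2 (`GhostLegProfile.exists_Ggh_profile`, scales `n = L^k`, `L ≥ 2`) — hence the row is stated on
those scales only.  No definition, no `def … : Prop`, nothing cited, 0 sorry.  0 root-level binders of row D1 discharged (hW ∕ hR-sockets ∕ hSX-socket ∕ D1Tel ∕
D1Rep = 0); (K) NOT closed (the END consumes these rows under the OWNER's ρ-g20-2 ∕ an2's R-D1-g45-4 architecture, not here); NOT D1, NOT `BetaPertH`,
NOT continuum, NOT Clay.

ABSOLUTE RULE (cell charter, verbatim): «No internally-minted statement may enter as a cited fact. Every hypothesis is either kernel-proved in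
this package or a verbatim quotation of a PUBLISHED theorem with page reference. The manuscript(s) under audit are NOT citable for their own
disputed steps — they are the thing under adjudication; programme-internal (2001/route/tribunal) claims are never citable.»

CONTENT ([folklore]; `L ≥ 2`, `0 < a`; `n = m + 1`, `N := (n : ℝ)`; root `ρ = ctrHalf n` as in `GhostDeltaWords`; `V_Q := vertexRedF n (SghAt ρ n 0 a)`,
`V_K := vertexRedF n (SghAt ρ n n² 0)`, `W_Q := tableRedF n (WghAt ρ n (−1) 0 a)`; common leg rate `δβ∕2`, coarse rate `r₀ := min (κ₄∕16) (2·(δβ∕2))∕2∕4`).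
* §0 `M5_nonneg`, `M6_nonneg` (F4's weight constants are nonnegative), **`fourTerm_bookkeeping`** (F2's four-term constant in the `n⁻⁸` currency: F2 §5 ×4).
* §1 **`sharp_QK`**, **`sharp_KQ`**, **`sharp_QQ`**: for β2's letters `hG` (value ∕ left ∕ right profiles of `Ggh`, constant `C∕N²`, rates `≤ δβ`, on `n = L^k`; `L` implicit):
  `∃ K, ∀ k ≥ 1, ∀ m, m+1 = L^k → ∀ μ ν, Decay510 (z ↦ bubble (Ggh n a) (V_· μ 0) (V_· ν z)) (K·(N⁸)⁻¹) r₀` — F2 `decay510_biBubble_of_twoTerm` with the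
  `Q′`-side flat majorant of (Δ2) §1 (exponent `0`, `≍ n⁻⁸`) and∕or the `K`-side two-term majorant of (Δ2) §2 (exponents `3, 2`); sums `≤ 3`.
* §2 **`decay510_deltaGH`** (ΔGH as a (5.10)-kernel `K·(N⁸)⁻¹` at a rate `r > 0`: three bubbles + (Δ2)'s tadpole at the weaker rate, `decay510_add`),
  **`sharp_deltaGH`**: the row, one constant (`abs_secondMoment_le`).
NOT HERE (honest): the value of `K`; scales `n ∉ {L^k}`; the END's consumption; (d3-BR) (the same row BY NAME at the straight pin, separately); anything of Bałaban's.
Unit `b2b-balaban-beta-d1-formalise-leaf-04` (gen 27), D1 formalisation swarm, road «BF-x»; INTENT-3 [D1LEAF04-G27-INTENT-3]. Not in print; no existing file touched.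
-/

noncomputable section

namespace Summit.QuantumFields.BalabanUV.Beta.D1BFx.RestKernelGhostDeltaSharp

open scoped BigOperators
open Finset
open Literature.MathematicalPhysics.QuantumFieldTheory.Balaban1983to89
open Literature.MathematicalPhysics.QuantumFieldTheory.Balaban1983to89.Beta
open Literature.MathematicalPhysics.QuantumFieldTheory.Balaban1983to89.T4RateAlgebra (decay510_add decay510_neg)
open B12Sec2to5 (l1 Decay510)
open B5Hk163Strip (kappa163 kappa163_pos)
open B5Hk163TorusHolderDecay (MD163)
open B5Hk163Decay (MG163)
open B4TorusKernel (periodConst)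
open ExpKernelCalculus (Site MKer comp tr tadpole bubble decay510_mono_const)
open AffineAveraging (unitVec)
open PoissonInterior (supNorm nrm nrm_pos)
open Summit.QuantumFields.BalabanUV.Beta.D1BFx.PackedKernelSplit (biBubble bubble_eq_biBubble)
open Summit.QuantumFields.BalabanUV.Beta.D1BFx.GhostLeg (Ggh)
open Summit.QuantumFields.BalabanUV.Beta.D1BFx.GhostStencilRooted (SghAt)
open Summit.QuantumFields.BalabanUV.Beta.D1BFx.GhostStencilRootedReflection (ctrHalf ctrHalf_mem)
open Summit.QuantumFields.BalabanUV.Beta.D1BFx.GhostAveragingSquare (WghAt)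
open Summit.QuantumFields.BalabanUV.Beta.D1BFx.GhostKernelComplete (PghQ)
open Summit.QuantumFields.BalabanUV.Beta.D1BFx.ReducedKernelF (vertexRedF)
open Summit.QuantumFields.BalabanUV.Beta.D1BFx.ReducedTableF (tableRedF)
open Summit.QuantumFields.BalabanUV.Beta.D1BFx.GhostDeltaWords (deltaGH_eq_words)
open Summit.QuantumFields.BalabanUV.Beta.D1BFx.GhostVertexDensities (abs_ghostWeight_le abs_ghostWeight_sub_le)
open Summit.QuantumFields.BalabanUV.Beta.D1BFx.OrientedProfileWords (decay510_biBubble_of_twoTerm pow_bookkeeping)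
open Summit.QuantumFields.BalabanUV.Beta.D1BFx.GhostRowBookkeeping (K_diff_le K_value_le)
open Summit.QuantumFields.BalabanUV.Beta.D1BFx.RestKernelGhostUnit (abs_secondMoment_le momentSum_nonneg)
open Summit.QuantumFields.BalabanUV.Beta.D1BFx.GhostLegProfilesRight (ggh_profiles)
open Summit.QuantumFields.BalabanUV.Beta.D1BFx.GhostQWordLetters (abs_comp_Ggh_VQ_le abs_comp_Ggh_VK_le decay510_tadpole_Ggh_WQ_pow)

/-! ## §0 Nonnegativity of F4's constants and the four-term bookkeeping -/

/-- [folklore] F4's value-weight constant is nonnegative (its letter bounds an absolute value with positive factors). -/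
theorem M5_nonneg (m : ℕ) : 0 ≤ MG163 4 * periodConst (kappa163 4) 3 := by
  have h := abs_ghostWeight_le m 1 0 0 0 0
  have h1 : 0 ≤ |(1:ℝ)| * ((((m + 1 : ℕ) : ℝ) ^ 5)⁻¹ * (MG163 4 * periodConst (kappa163 4) 3) * Real.exp (kappa163 4 / 4)) :=
    (mul_nonneg_iff_of_pos_right (Real.exp_pos _)).1 ((abs_nonneg _).trans h)
  rw [abs_one, one_mul] at h1
  have h2 : 0 < (((m + 1 : ℕ) : ℝ) ^ 5)⁻¹ := by positivity
  exact (mul_nonneg_iff_of_pos_left h2).1 ((mul_nonneg_iff_of_pos_right (Real.exp_pos _)).1 h1)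

/-- [folklore] F4's difference-weight constant is nonnegative. -/
theorem M6_nonneg (m : ℕ) : 0 ≤ MD163 4 * periodConst (kappa163 4) 3 := by
  have h := abs_ghostWeight_sub_le m 1 0 0 0 0
  have h1 : 0 ≤ |(1:ℝ)| * ((((m + 1 : ℕ) : ℝ) ^ 6)⁻¹ * ((MD163 4 * periodConst (kappa163 4) 3) * Real.exp (kappa163 4 / 4)) * Real.exp (kappa163 4 / 16)) :=
    (mul_nonneg_iff_of_pos_right (Real.exp_pos _)).1 ((abs_nonneg _).trans h)
  rw [abs_one, one_mul] at h1
  have h2 : 0 < (((m + 1 : ℕ) : ℝ) ^ 6)⁻¹ := by positivity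
  have h3 := (mul_nonneg_iff_of_pos_left h2).1 ((mul_nonneg_iff_of_pos_right (Real.exp_pos _)).1 h1)
  exact (mul_nonneg_iff_of_pos_right (Real.exp_pos _)).1 h3

/-- [folklore] **F2's FOUR-TERM CONSTANT IN THE `n⁻⁸` CURRENCY**: `Kᵢ ≤ cᵢ∕N^{eᵢ}` (`Kᵢ, Mᵢⱼ, c′, F ≥ 0`) and the four power conditions `qᵢⱼ + 8 ≤ eᵢ + eⱼ`
(`1 ≤ N`) give `F·((K₁K₃M₁₃N^{q₁₃} + K₁K₄M₁₄N^{q₁₄} + K₂K₃M₂₃N^{q₂₃} + K₂K₄M₂₄N^{q₂₄})·c′) ≤ (F·((c₁c₃M₁₃ + c₁c₄M₁₄ + c₂c₃M₂₃ + c₂c₄M₂₄)·c′))·(N⁸)⁻¹`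
(F2 `pow_bookkeeping` ×4 — F5 PART 2's count with the two vertex sides allowed to differ). -/
theorem fourTerm_bookkeeping {n : ℕ} (hn : 1 ≤ n) {F c' K₁ K₂ K₃ K₄ c₁ c₂ c₃ c₄ M₁₃ M₁₄ M₂₃ M₂₄ : ℝ} {e₁ e₂ e₃ e₄ q₁₃ q₁₄ q₂₃ q₂₄ : ℕ}
    (hF : 0 ≤ F) (hc' : 0 ≤ c') (hK₁ : 0 ≤ K₁) (hK₂ : 0 ≤ K₂) (hK₃ : 0 ≤ K₃) (hK₄ : 0 ≤ K₄)
    (hM₁₃ : 0 ≤ M₁₃) (hM₁₄ : 0 ≤ M₁₄) (hM₂₃ : 0 ≤ M₂₃) (hM₂₄ : 0 ≤ M₂₄)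
    (h₁ : K₁ ≤ c₁ / (n : ℝ) ^ e₁) (h₂ : K₂ ≤ c₂ / (n : ℝ) ^ e₂) (h₃ : K₃ ≤ c₃ / (n : ℝ) ^ e₃) (h₄ : K₄ ≤ c₄ / (n : ℝ) ^ e₄)
    (q13 : q₁₃ + 8 ≤ e₁ + e₃) (q14 : q₁₄ + 8 ≤ e₁ + e₄) (q23 : q₂₃ + 8 ≤ e₂ + e₃) (q24 : q₂₄ + 8 ≤ e₂ + e₄) :
    F * ((K₁ * K₃ * M₁₃ * (n : ℝ) ^ q₁₃ + K₁ * K₄ * M₁₄ * (n : ℝ) ^ q₁₄ + K₂ * K₃ * M₂₃ * (n : ℝ) ^ q₂₃ + K₂ * K₄ * M₂₄ * (n : ℝ) ^ q₂₄) * c')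
      ≤ (F * ((c₁ * c₃ * M₁₃ + c₁ * c₄ * M₁₄ + c₂ * c₃ * M₂₃ + c₂ * c₄ * M₂₄) * c')) * ((n : ℝ) ^ 8)⁻¹ := by
  have t13 := pow_bookkeeping hn hK₁ hK₃ hM₁₃ h₁ h₃ q13
  have t14 := pow_bookkeeping hn hK₁ hK₄ hM₁₄ h₁ h₄ q14
  have t23 := pow_bookkeeping hn hK₂ hK₃ hM₂₃ h₂ h₃ q23
  have t24 := pow_bookkeeping hn hK₂ hK₄ hM₂₄ h₂ h₄ q24
  have hsum := add_le_add (add_le_add (add_le_add t13 t14) t23) t24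
  have h := mul_le_mul_of_nonneg_left (mul_le_mul_of_nonneg_right hsum hc') hF
  exact h.trans (le_of_eq (by ring))

/-! ## §1 The three bubble words of ΔGH at the tower weight -/

section Words

variable {L : ℕ} {a : ℝ} {δβ C : ℝ} (hδβ : 0 < δβ) (hC : 0 < C)
  (hG : ∀ (k : ℕ), 1 ≤ k → ∀ (n : ℕ) [NeZero n], n = L ^ k → ∀ δ' : ℝ, 0 ≤ δ' → δ' ≤ δβ →
    (∀ x y : Site 4, |Ggh n a x y () ()| ≤ (C / (n : ℝ) ^ 2) / nrm (x - y) ^ 2 * Real.exp (-(δ' / n) * supNorm (x - y))) ∧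
    (∀ (x y : Site 4) (μ : Fin 4), |Ggh n a (x + unitVec μ) y () () - Ggh n a x y () ()|
        ≤ (C / (n : ℝ) ^ 2) / nrm (x - y) ^ 3 * Real.exp (-(δ' / n) * supNorm (x - y))) ∧
    (∀ (x y : Site 4) (μ : Fin 4), |Ggh n a x (y + unitVec μ) () () - Ggh n a x y () ()|
        ≤ (C / (n : ℝ) ^ 2) / nrm (x - y) ^ 3 * Real.exp (-(δ' / n) * supNorm (x - y))))
include hδβ hC hG

/-- [folklore] **THE `QK` BUBBLE AT THE TOWER WEIGHT**: `∃ K, ∀ k ≥ 1, ∀ m, m+1 = L^k → ∀ μ ν,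
Decay510 (z ↦ bubble (Ggh n a) (V_Q μ 0) (V_K ν z)) (K·(N⁸)⁻¹) r₀` — `Q′`-side flat (exponent 0, `c_Q∕N⁸`), `K`-side F1 (exponents 3, 2; `∕N⁵`, `∕N⁶`);
F2's sums `0+3, 0+2 ≤ 3`; counts `5 + 8 ≤ 8 + 5`, `6 + 8 ≤ 8 + 6`. -/
theorem sharp_QK : ∃ K : ℝ, ∀ (k : ℕ), 1 ≤ k → ∀ (m : ℕ), m + 1 = L ^ k → ∀ μ ν : Fin 4,
    Decay510 (fun z => bubble (Ggh (m + 1) a) (vertexRedF (m + 1) (SghAt (ctrHalf (m + 1)) (m + 1) 0 a) μ 0)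
        (vertexRedF (m + 1) (SghAt (ctrHalf (m + 1)) (m + 1) ((((m + 1 : ℕ) : ℝ)) ^ 2) 0) ν z))
      (K * ((((m + 1 : ℕ) : ℝ)) ^ 8)⁻¹) (min (kappa163 4 / 16) (2 * (δβ / 2)) / 2 / (4 : ℕ)) := by
  have hσ : 0 < kappa163 4 / 16 := by have := kappa163_pos 4; positivity
  have hε : 0 < min (kappa163 4 / 16) (2 * (δβ / 2)) := lt_min hσ (by linarith)
  have h2 : 0 < δβ / 2 := by linarith
  exact ⟨_, fun k hk m hm μ ν => by
    have hn : 1 ≤ m + 1 := Nat.le_add_left 1 m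
    have hN : (1 : ℝ) ≤ ((m + 1 : ℕ) : ℝ) := by exact_mod_cast hn
    have hM5 := M5_nonneg m
    have hM6 := M6_nonneg m
    obtain ⟨hG0, -, -⟩ := hG k hk (m + 1) hm δβ hδβ.le le_rfl
    obtain ⟨hG0h, -, hG2h⟩ := hG k hk (m + 1) hm (δβ / 2) h2.le (by linarith)
    have hA := fun y x z g f => abs_comp_Ggh_VQ_le m (ctrHalf_mem (m + 1)) hC.le hδβ hG0 a μ y x z g f
    have hB := fun y z x f g => abs_comp_Ggh_VK_le m (ctrHalf (m + 1)) hC.le h2.le hG0h hG2h ((((m + 1 : ℕ) : ℝ)) ^ 2) ν y z x f g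
    have h := decay510_biBubble_of_twoTerm (D := 4) (F := Unit) (by norm_num) hn (L₁ := Ggh (m + 1) a) (L₂ := Ggh (m + 1) a)
      (𝒱 := vertexRedF (m + 1) (SghAt (ctrHalf (m + 1)) (m + 1) 0 a))
      (𝒱' := vertexRedF (m + 1) (SghAt (ctrHalf (m + 1)) (m + 1) ((((m + 1 : ℕ) : ℝ)) ^ 2) 0)) μ ν
      (by positivity) le_rfl (by positivity) (by positivity) h2 hσ (by norm_num) (by norm_num) (by norm_num) (by norm_num) hA hB
    have hK₃ := K_diff_le (a' := 3) (δ := δβ / 2) hN hM5 (Real.exp_pos (kappa163 4 / 4)).le (le_refl (C / (((m + 1 : ℕ) : ℝ)) ^ 2))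
    have hK₄ := K_value_le (a := 2) (δ := δβ / 2) hN (mul_nonneg hM6 (Real.exp_pos (kappa163 4 / 4)).le) (Real.exp_pos (kappa163 4 / 16)).le
      (le_refl (C / (((m + 1 : ℕ) : ℝ)) ^ 2))
    exact decay510_mono_const h (fourTerm_bookkeeping hn (by positivity) (by positivity) (by positivity) le_rfl (by positivity) (by positivity)
      (by positivity) (by positivity) (by positivity) (by positivity)
      le_rfl (le_of_eq (zero_div ((((m + 1 : ℕ) : ℝ)) ^ 8)).symm) hK₃ hK₄ (by norm_num) (by norm_num) (by norm_num) (by norm_num))⟩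

/-- [folklore] **THE `KQ` BUBBLE AT THE TOWER WEIGHT** (the sides swapped: `K`-side exponents `3, 2` first, `Q′`-side flat second). -/
theorem sharp_KQ : ∃ K : ℝ, ∀ (k : ℕ), 1 ≤ k → ∀ (m : ℕ), m + 1 = L ^ k → ∀ μ ν : Fin 4,
    Decay510 (fun z => bubble (Ggh (m + 1) a) (vertexRedF (m + 1) (SghAt (ctrHalf (m + 1)) (m + 1) ((((m + 1 : ℕ) : ℝ)) ^ 2) 0) μ 0)
        (vertexRedF (m + 1) (SghAt (ctrHalf (m + 1)) (m + 1) 0 a) ν z))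
      (K * ((((m + 1 : ℕ) : ℝ)) ^ 8)⁻¹) (min (kappa163 4 / 16) (2 * (δβ / 2)) / 2 / (4 : ℕ)) := by
  have hσ : 0 < kappa163 4 / 16 := by have := kappa163_pos 4; positivity
  have hε : 0 < min (kappa163 4 / 16) (2 * (δβ / 2)) := lt_min hσ (by linarith)
  have h2 : 0 < δβ / 2 := by linarith
  exact ⟨_, fun k hk m hm μ ν => by
    have hn : 1 ≤ m + 1 := Nat.le_add_left 1 m
    have hN : (1 : ℝ) ≤ ((m + 1 : ℕ) : ℝ) := by exact_mod_cast hn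
    have hM5 := M5_nonneg m
    have hM6 := M6_nonneg m
    obtain ⟨hG0, -, -⟩ := hG k hk (m + 1) hm δβ hδβ.le le_rfl
    obtain ⟨hG0h, -, hG2h⟩ := hG k hk (m + 1) hm (δβ / 2) h2.le (by linarith)
    have hA := fun y x z g f => abs_comp_Ggh_VK_le m (ctrHalf (m + 1)) hC.le h2.le hG0h hG2h ((((m + 1 : ℕ) : ℝ)) ^ 2) μ y x z g f
    have hB := fun y z x f g => abs_comp_Ggh_VQ_le m (ctrHalf_mem (m + 1)) hC.le hδβ hG0 a ν y z x f g
    have h := decay510_biBubble_of_twoTerm (D := 4) (F := Unit) (by norm_num) hn (L₁ := Ggh (m + 1) a) (L₂ := Ggh (m + 1) a)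
      (𝒱 := vertexRedF (m + 1) (SghAt (ctrHalf (m + 1)) (m + 1) ((((m + 1 : ℕ) : ℝ)) ^ 2) 0))
      (𝒱' := vertexRedF (m + 1) (SghAt (ctrHalf (m + 1)) (m + 1) 0 a)) μ ν
      (by positivity) (by positivity) (by positivity) le_rfl h2 hσ (by norm_num) (by norm_num) (by norm_num) (by norm_num) hA hB
    have hK₁ := K_diff_le (a' := 3) (δ := δβ / 2) hN hM5 (Real.exp_pos (kappa163 4 / 4)).le (le_refl (C / (((m + 1 : ℕ) : ℝ)) ^ 2))
    have hK₂ := K_value_le (a := 2) (δ := δβ / 2) hN (mul_nonneg hM6 (Real.exp_pos (kappa163 4 / 4)).le) (Real.exp_pos (kappa163 4 / 16)).le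
      (le_refl (C / (((m + 1 : ℕ) : ℝ)) ^ 2))
    exact decay510_mono_const h (fourTerm_bookkeeping hn (by positivity) (by positivity) (by positivity) (by positivity) (by positivity) le_rfl
      (by positivity) (by positivity) (by positivity) (by positivity)
      hK₁ hK₂ le_rfl (le_of_eq (zero_div ((((m + 1 : ℕ) : ℝ)) ^ 8)).symm) (by norm_num) (by norm_num) (by norm_num) (by norm_num))⟩

/-- [folklore] **THE `QQ` BUBBLE AT THE TOWER WEIGHT** (both sides flat `c_Q∕N⁸`: `8 + 8 ≤ 8 + 8`). -/
theorem sharp_QQ : ∃ K : ℝ, ∀ (k : ℕ), 1 ≤ k → ∀ (m : ℕ), m + 1 = L ^ k → ∀ μ ν : Fin 4,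
    Decay510 (fun z => bubble (Ggh (m + 1) a) (vertexRedF (m + 1) (SghAt (ctrHalf (m + 1)) (m + 1) 0 a) μ 0)
        (vertexRedF (m + 1) (SghAt (ctrHalf (m + 1)) (m + 1) 0 a) ν z))
      (K * ((((m + 1 : ℕ) : ℝ)) ^ 8)⁻¹) (min (kappa163 4 / 16) (2 * (δβ / 2)) / 2 / (4 : ℕ)) := by
  have hσ : 0 < kappa163 4 / 16 := by have := kappa163_pos 4; positivity
  have hε : 0 < min (kappa163 4 / 16) (2 * (δβ / 2)) := lt_min hσ (by linarith)
  have h2 : 0 < δβ / 2 := by linarith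
  exact ⟨_, fun k hk m hm μ ν => by
    have hn : 1 ≤ m + 1 := Nat.le_add_left 1 m
    have hM5 := M5_nonneg m
    obtain ⟨hG0, -, -⟩ := hG k hk (m + 1) hm δβ hδβ.le le_rfl
    have hA := fun y x z g f => abs_comp_Ggh_VQ_le m (ctrHalf_mem (m + 1)) hC.le hδβ hG0 a μ y x z g f
    have hB := fun y z x f g => abs_comp_Ggh_VQ_le m (ctrHalf_mem (m + 1)) hC.le hδβ hG0 a ν y z x f g
    have h := decay510_biBubble_of_twoTerm (D := 4) (F := Unit) (by norm_num) hn (L₁ := Ggh (m + 1) a) (L₂ := Ggh (m + 1) a)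
      (𝒱 := vertexRedF (m + 1) (SghAt (ctrHalf (m + 1)) (m + 1) 0 a))
      (𝒱' := vertexRedF (m + 1) (SghAt (ctrHalf (m + 1)) (m + 1) 0 a)) μ ν
      (by positivity) le_rfl (by positivity) le_rfl h2 hσ (by norm_num) (by norm_num) (by norm_num) (by norm_num) hA hB
    exact decay510_mono_const h (fourTerm_bookkeeping hn (by positivity) (by positivity) (by positivity) le_rfl (by positivity) le_rfl
      (by positivity) (by positivity) (by positivity) (by positivity)
      le_rfl (le_of_eq (zero_div ((((m + 1 : ℕ) : ℝ)) ^ 8)).symm) le_rfl (le_of_eq (zero_div ((((m + 1 : ℕ) : ℝ)) ^ 8)).symm)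
      (by norm_num) (by norm_num) (by norm_num) (by norm_num))⟩

end Words

/-! ## §2 The sharp ΔGH row -/

/-- [folklore] **ΔGH AS A (5.10)-KERNEL AT THE TOWER WEIGHT**: for `L ≥ 2`, `0 < a` there are `K` and a rate `r > 0` such that for every `k ≥ 1`, `n = m + 1 = L^k`
and every `(μ, ν)`, `Decay510 (z ↦ 2·(PghQ n a (−1) n² 0 μ ν z − PghQ n a (−1) n² a μ ν z)) (K·n⁻⁸) r` — the three bubbles of §1 + (Δ2)'s tadpole at the
common rate `r = min (κ₄∕16) (2·(δβ∕2))∕2∕4` (`GhostDeltaWords.deltaGH_eq_words`, `decay510_add ∕ _neg ∕ _mono`). -/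
theorem decay510_deltaGH {L : ℕ} (hL : 2 ≤ L) {a : ℝ} (ha : 0 < a) : ∃ K r : ℝ, 0 < r ∧ ∀ (k : ℕ), 1 ≤ k → ∀ (m : ℕ), m + 1 = L ^ k → ∀ μ ν : Fin 4,
    Decay510 ((fun μ ν z => 2 * (PghQ (m + 1) a (-1) ((((m + 1 : ℕ) : ℝ)) ^ 2) 0 μ ν z
        - PghQ (m + 1) a (-1) ((((m + 1 : ℕ) : ℝ)) ^ 2) a μ ν z)) μ ν) (K * ((((m + 1 : ℕ) : ℝ)) ^ 8)⁻¹) r := by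
  obtain ⟨δβ, C, hδβ, hC, hG⟩ := ggh_profiles hL ha
  obtain ⟨K₁, h1⟩ := sharp_QK hδβ hC hG
  obtain ⟨K₂, h2⟩ := sharp_KQ hδβ hC hG
  obtain ⟨K₃, h3⟩ := sharp_QQ hδβ hC hG
  have hσ : 0 < kappa163 4 / 16 := by have := kappa163_pos 4; positivity
  set r₀ : ℝ := min (kappa163 4 / 16) (2 * (δβ / 2)) / 2 / (4 : ℕ) with hr₀
  have hr₀0 : 0 < r₀ := by have := lt_min hσ (by linarith : (0:ℝ) < 2 * (δβ / 2)); positivity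
  have hr₀T : r₀ ≤ kappa163 4 / 16 / 2 / (4 : ℕ) :=
    div_le_div_of_nonneg_right (div_le_div_of_nonneg_right (min_le_left _ _) (by norm_num)) (by norm_num)
  set KT : ℝ := (Fintype.card Unit : ℝ) ^ 2 *
      (GhostLegBlockMass.cNear a * (|(-1 : ℝ)| * |a| * (64 * ((MG163 4 * periodConst (kappa163 4) 3) * Real.exp (kappa163 4 / 4) * Real.exp (kappa163 4 / 4)) ^ 2))
        * (1 + 2 * (4 : ℕ) * 3 ^ ((4 : ℕ) - 1) * (((4 : ℕ) - 1).factorial * (4 / (kappa163 4 / 16)) ^ ((4 : ℕ) - 1) * (1 + 4 / (kappa163 4 / 16))))) with hKT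
  refine ⟨KT + K₁ + K₂ + K₃, r₀, hr₀0, fun k hk m hm μ ν => ?_⟩
  have hT := decay510_mono (decay510_tadpole_Ggh_WQ_pow m (ctrHalf_mem (m + 1)) ha (-1) a μ ν) hr₀T
  have hΔ : Decay510 ((fun μ ν z => 2 * (PghQ (m + 1) a (-1) ((((m + 1 : ℕ) : ℝ)) ^ 2) 0 μ ν z
        - PghQ (m + 1) a (-1) ((((m + 1 : ℕ) : ℝ)) ^ 2) a μ ν z)) μ ν)
      (KT * ((((m + 1 : ℕ) : ℝ)) ^ 8)⁻¹
        + (K₁ * ((((m + 1 : ℕ) : ℝ)) ^ 8)⁻¹ + K₂ * ((((m + 1 : ℕ) : ℝ)) ^ 8)⁻¹ + K₃ * ((((m + 1 : ℕ) : ℝ)) ^ 8)⁻¹)) r₀ :=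
    decay510_add (decay510_neg hT) (decay510_add (decay510_add (h1 k hk m hm μ ν) (h2 k hk m hm μ ν) (fun _ => rfl)) (h3 k hk m hm μ ν) (fun _ => rfl))
      fun z => by
        show 2 * (PghQ (m + 1) a (-1) ((((m + 1 : ℕ) : ℝ)) ^ 2) 0 μ ν z - PghQ (m + 1) a (-1) ((((m + 1 : ℕ) : ℝ)) ^ 2) a μ ν z) = _
        rw [deltaGH_eq_words (m + 1) ha μ ν z]
  exact decay510_mono_const hΔ (le_of_eq (by ring))

/-- [folklore] **THE SHARP ΔGH ROW OF SLOT (K)**: for `L ≥ 2`, `0 < a` there is `K` such that for every `k ≥ 1`, `n = m + 1 = L^k` and every channel `(μ, ν)`,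
`|secondMoment (μ ν z ↦ 2·(PghQ n a (−1) n² 0 μ ν z − PghQ n a (−1) n² a μ ν z)) μ ν| ≤ K·n⁻⁸` — the defect row of `RestKernelGhostDelta.abs_secondMoment_deltaGH_le`
(there `KΔ(a)·n⁻¹`, VERBATIM the same function) at the tower weight (GHOST-N8-SPEC v0.3 §3 (d3-Δ)). -/
theorem sharp_deltaGH {L : ℕ} (hL : 2 ≤ L) {a : ℝ} (ha : 0 < a) : ∃ K : ℝ, ∀ (k : ℕ), 1 ≤ k → ∀ (m : ℕ), m + 1 = L ^ k → ∀ μ ν : Fin 4,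
    |B12Beta.secondMoment (fun μ ν z => 2 * (PghQ (m + 1) a (-1) ((((m + 1 : ℕ) : ℝ)) ^ 2) 0 μ ν z
        - PghQ (m + 1) a (-1) ((((m + 1 : ℕ) : ℝ)) ^ 2) a μ ν z)) μ ν|
      ≤ K * ((((m + 1 : ℕ) : ℝ)) ^ 8)⁻¹ := by
  obtain ⟨K, r, hr, h⟩ := decay510_deltaGH hL ha
  refine ⟨K * ∑' x : Site 4, l1 x ^ 2 * Real.exp (-r * l1 x), fun k hk m hm μ ν => ?_⟩
  refine (abs_secondMoment_le hr (h k hk m hm μ ν)).trans (le_of_eq ?_)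
  ring

end Summit.QuantumFields.BalabanUV.Beta.D1BFx.RestKernelGhostDeltaSharp

end
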